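import Summits.BirchSwinnertonDyer.BirchSwinnertonDyer.Theorems.SmallImageMuTransferMuTransferX9CentralScalarOdd
import HarnessLib

set_option autoImplicit false

-- the summit and its single problem are both named `BirchSwinnertonDyer` (registry layout D-0017)
set_option linter.dupNamespace false

/-!
# The central scalar at level `p^{d+1}`: a `p`-power of the mod-`p` central scalar `σ₀ ∈ Gal(ℚ̄/ℚ_∞)` acts on
# `E[p^k]` as a scalar `≢ 1 (mod p)` (Teichmüller / Schur–Zassenhaus lift, elementary form) — service lemma for
# `stub_kolyvaginPrimePkX9` (Chebotarev at `p`-level `d+1`, MEMO-es §15 STEP 2 «the Sah step uses the Teichmüller scalar»)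

Seat `bsd-line-k6-p4` (prover-bsd-line-k6-p4-g4-0, 4th LEAD on crux stmt-BirchSwinnertonDyer-20547, line `graded_euler_loss`,
skeleton v3).  THEOREMS ONLY, sorry-free, no definition, nothing asserted about any curve beyond what the kernel proves.
`--supports stmt-BirchSwinnertonDyer-20547`.

* §1 (any additive commutative group `A`, any additive endomorphism `σ`): if `σ` acts as the integer scalar `b` on
  `A[p^i]` (`i ≥ 1`) then `σ^{p^i}` acts as `b^{p^i}` on `A[p^{i+1}]` (`iterate_prime_pow_eq_smul_of_torsion_succ`:
  `σ^n x = b^n x + n b^{n−1}(σx − bx)` and `p^i (σx − bx) = 0`); hence if `σ = a` on `A[p]` and `p^k A = 0` then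
  `σ^{p^M} = a^{p^M}` on `A` for some `M` (`exists_iterate_prime_pow_eq_pow_smul`).  No structure theory, no matrices.
* §2 (`E/ℚ`, `p` odd, `E[p]` irreducible, `ρ̄` not surjective): from the tree's mod-`p` central scalar
  `exists_mem_kerSubgroup_smul_eq_of_ne_two` (`σ₀ ∈ ker κ`, `σ₀ = a ≠ 1` on `E[p]`), an element `σ₁ ∈ ker κ` acting on
  `E[p^k]` as an INTEGER scalar `c` with `c ≢ 1 (mod p)` (`exists_mem_kerSubgroup_smul_eq_pk_of_ne_two`; `c = a^{p^M}`,
  `≡ a` by Fermat).  This is the level-`p^k` input of the Sah / coset step of `stub_kolyvaginPrimePkX9`.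

References: C.-H. Sah, J. Algebra 10 (1968) Prop. 2.7 (b) [Sah1968]; J.-P. Serre, Invent. Math. 15 (1972) §2.4 Prop. 15,
§2.6 [Serre1972]; HOME/MEMO-es.md §15 STEP 2.
-/

noncomputable section

open Field WeierstrassCurve Literature.NumberTheory.EllipticCurves Literature.NumberTheory.GaloisRepresentations Function
open Summit.BirchSwinnertonDyer.BirchSwinnertonDyer.Rank1Residual

namespace Summit.BirchSwinnertonDyer.BirchSwinnertonDyer.Theorems.OneSidedTwistSqueezeX9KatoDivisibilityX9CentralScalarPk

/-! ## §1 Powers of an endomorphism that is a scalar on the `p`-torsion -/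

section Algebra

variable {A : Type*} [AddCommGroup A] (σ : A →+ A)

/-- If `σ` acts as the scalar `b` on `A[p^i]` and `p^{i+1} x = 0` (`i ≥ 1`), then `δ := σx − bx` is killed by `p^i`,
so `σ δ = b δ`, and `σ^n x = b^n x + n·b^{n−1}·δ` for every `n`. [folklore] -/
theorem iterate_apply_eq_of_torsion_succ {p : ℕ} {i : ℕ} (hi : 1 ≤ i) (b : ℤ)
    (hσ : ∀ y : A, ((p : ℤ) ^ i) • y = 0 → σ y = b • y) (x : A) (hx : ((p : ℤ) ^ (i + 1)) • x = 0) (n : ℕ) :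
    σ^[n] x = (b ^ n) • x + ((n : ℤ) * b ^ (n - 1)) • (σ x - b • x) := by
  -- `δ = σ x − b x` is `p^i`-torsion
  have hδ : ((p : ℤ) ^ i) • (σ x - b • x) = 0 := by
    have hy : ((p : ℤ) ^ i) • (((p : ℤ) ^ i) • x) = 0 := by
      rw [smul_smul, ← pow_add]
      obtain ⟨j, hj⟩ : ∃ j, i + i = (i + 1) + j := ⟨i - 1, by omega⟩
      rw [hj, pow_add, mul_comm, mul_smul, hx, smul_zero]
    have h1 := hσ (((p : ℤ) ^ i) • x) hy
    rw [map_zsmul] at h1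
    rw [smul_sub, smul_comm, h1, sub_self]
  have hσδ : σ (σ x - b • x) = b • (σ x - b • x) := hσ _ hδ
  induction n with
  | zero => simp
  | succ n ih =>
    rw [Function.iterate_succ_apply', ih, map_add, map_zsmul, map_zsmul, hσδ]
    -- `σ x = b x + δ`
    have hσx : σ x = b • x + (σ x - b • x) := by abel
    conv_lhs => rw [hσx]
    rcases Nat.eq_zero_or_pos n with rfl | hn
    · simp
    · obtain ⟨m, rfl⟩ : ∃ m, n = m + 1 := ⟨n - 1, by omega⟩
      simp only [Nat.add_sub_cancel, Nat.cast_add, Nat.cast_one, pow_succ]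
      module

/-- **`σ = b` on `A[p^i]` (`i ≥ 1`) ⟹ `σ^{p^i} = b^{p^i}` on `A[p^{i+1}]`.** [folklore] -/
theorem iterate_prime_pow_eq_smul_of_torsion_succ {p : ℕ} {i : ℕ} (hi : 1 ≤ i) (b : ℤ)
    (hσ : ∀ y : A, ((p : ℤ) ^ i) • y = 0 → σ y = b • y) (x : A) (hx : ((p : ℤ) ^ (i + 1)) • x = 0) :
    σ^[p ^ i] x = (b ^ p ^ i) • x := by
  rw [iterate_apply_eq_of_torsion_succ σ hi b hσ x hx (p ^ i)]
  have hδ : ((p : ℤ) ^ i) • (σ x - b • x) = 0 := by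
    -- as in the previous lemma
    have hy : ((p : ℤ) ^ i) • (((p : ℤ) ^ i) • x) = 0 := by
      rw [smul_smul, ← pow_add]
      obtain ⟨j, hj⟩ : ∃ j, i + i = (i + 1) + j := ⟨i - 1, by omega⟩
      rw [hj, pow_add, mul_comm, mul_smul, hx, smul_zero]
    have h1 := hσ (((p : ℤ) ^ i) • x) hy
    rw [map_zsmul] at h1
    rw [smul_sub, smul_comm, h1, sub_self]
  rw [Nat.cast_pow, mul_comm, mul_smul, hδ, smul_zero, add_zero]

/-- **`σ = a` on `A[p]` and `p^k A = 0` ⟹ `σ^{p^M} = a^{p^M}` on `A` for some `M`** (induction on the torsion level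
with `iterate_prime_pow_eq_smul_of_torsion_succ`). [folklore] -/
theorem exists_iterate_prime_pow_eq_pow_smul {p : ℕ} (a : ℤ) (hσ : ∀ y : A, (p : ℤ) • y = 0 → σ y = a • y)
    {k : ℕ} (hA : ∀ x : A, ((p : ℤ) ^ k) • x = 0) :
    ∃ M : ℕ, ∀ x : A, σ^[p ^ M] x = (a ^ p ^ M) • x := by
  -- Claim(i): some `p`-power of `σ` is a power-of-`a` scalar on `A[p^i]`, for every `i ≥ 1`
  have claim : ∀ i : ℕ, ∃ M : ℕ, ∀ x : A, ((p : ℤ) ^ (i + 1)) • x = 0 → σ^[p ^ M] x = (a ^ p ^ M) • x := by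
    intro i
    induction i with
    | zero => exact ⟨0, fun x hx => by simpa using hσ x (by simpa using hx)⟩
    | succ i ih =>
      obtain ⟨M, hM⟩ := ih
      refine ⟨M + (i + 1), fun x hx => ?_⟩
      -- apply the one-step lemma to `τ = σ^{p^M}`, `b = a^{p^M}`, level `i + 1`
      have hz : ∀ n : ℕ, σ^[n] (0 : A) = 0 := fun n => by
        induction n with
        | zero => rfl
        | succ n ihn => rw [Function.iterate_succ_apply', ihn, map_zero]
      have hadd : ∀ (n : ℕ) (y z : A), σ^[n] (y + z) = σ^[n] y + σ^[n] z := fun n => by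
        induction n with
        | zero => intro y z; rfl
        | succ n ihn => intro y z; rw [Function.iterate_succ_apply', ihn, map_add,
            Function.iterate_succ_apply', Function.iterate_succ_apply']
      let τ : A →+ A :=
        { toFun := fun y => σ^[p ^ M] y
          map_zero' := hz _
          map_add' := fun y z => hadd _ y z }
      have hτ : ∀ y : A, ((p : ℤ) ^ (i + 1)) • y = 0 → τ y = (a ^ p ^ M) • y := fun y hy => hM y hy
      have h := iterate_prime_pow_eq_smul_of_torsion_succ τ (by omega) (a ^ p ^ M) hτ x hx
      have hiter : ∀ n (y : A), τ^[n] y = σ^[p ^ M * n] y := by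
        intro n
        induction n with
        | zero => intro y; simp
        | succ n ihn =>
          intro y
          rw [Function.iterate_succ_apply, ihn, Nat.mul_succ, Function.iterate_add_apply]
          rfl
      rw [hiter] at h
      rw [pow_add, pow_mul]
      exact h
  obtain ⟨M, hM⟩ := claim k
  exact ⟨M, fun x => hM x (by rw [pow_succ, mul_comm, mul_smul, hA, smul_zero])⟩

end Algebra

/-! ## §2 The central scalar on `E[p^k]` over `ℚ` at an odd prime with `E[p]` irreducible, `ρ̄` not surjective -/

section Curve

variable (W : WeierstrassCurve ℚ) [W.IsElliptic] (p : ℕ) [Fact p.Prime] (κ : ZpExtension ℚ p)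

/-- **The central scalar at level `p^k`.**  For `p ≠ 2`, `E[p]` irreducible and `ρ̄_{E,p}` not surjective there is
`σ₁ ∈ ker κ = Gal(ℚ̄/ℚ_∞)` acting on `E[p^k]` as an integer scalar `c` with `c ≢ 1 (mod p)`: take the tree's mod-`p`
central scalar `σ₀ ∈ ker κ` (`σ₀ = a ≠ 1` on `E[p]`, `exists_mem_kerSubgroup_smul_eq_of_ne_two`) and
`σ₁ := σ₀^{p^M}`, `c := a^{p^M} ≡ a (mod p)` (§1 + Fermat).  Level-`p^k` input of the Sah / coset step of
`stub_kolyvaginPrimePkX9` (MEMO-es §15 STEP 2: «the Teichmüller scalar `[λ̄]·1 ∈ ρ_{E,p^∞}(G_ℚ)`»).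
[cite: Serre1972, §2.4 Prop. 15 and §2.6] [cite: Sah1968, Prop. 2.7 (b)] -/
theorem exists_mem_kerSubgroup_smul_eq_pk_of_ne_two (hp2 : p ≠ 2) (hirr : W.HasIrreducibleModPGaloisRep p)
    (hns : ¬ W.HasSurjectiveModNGaloisRep p) (k : ℕ) :
    ∃ (σ₁ : absoluteGaloisGroup ℚ) (c : ℤ), ¬ ((p : ℤ) ∣ (c - 1)) ∧ σ₁ ∈ κ.kerSubgroup ∧
      ∀ P : geomTorsion W ((p : ℤ) ^ k), σ₁ • P = c • P := by
  have hp : p.Prime := Fact.out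
  obtain ⟨σ₀, a, ha1, hσ₀κ, hσ₀⟩ := exists_mem_kerSubgroup_smul_eq_of_ne_two W p κ hp2 hirr hns
  -- `σ₀` as an additive endomorphism of `E[p^k]`, scalar `a.val` on the `p`-torsion
  let σ : geomTorsion W ((p : ℤ) ^ k) →+ geomTorsion W ((p : ℤ) ^ k) := DistribSMul.toAddMonoidHom _ σ₀
  have hσ : ∀ y : geomTorsion W ((p : ℤ) ^ k), (p : ℤ) • y = 0 → σ y = (a.val : ℤ) • y := by
    intro y hy
    have hy' : (y : geomPoints W) ∈ geomTorsion W (p : ℤ) := by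
      simp only [Submodule.mem_toAddSubgroup, Submodule.mem_torsionBy_iff]
      have := congrArg (fun z : geomTorsion W ((p : ℤ) ^ k) => (z : geomPoints W)) hy
      simpa using this
    have h := hσ₀ ⟨(y : geomPoints W), hy'⟩
    apply Subtype.ext
    have h' := congrArg (fun z : geomTorsion W (p : ℤ) => (z : geomPoints W)) h
    simp only [Literature.NumberTheory.EllipticCurves.AddSubgroup.torsionBy.coe_smul] at h'
    change ((σ₀ • y : geomTorsion W ((p : ℤ) ^ k)) : geomPoints W) = (((a.val : ℤ) • y : geomTorsion W _) : geomPoints W)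
    rw [Literature.NumberTheory.EllipticCurves.AddSubgroup.torsionBy.coe_smul, AddSubgroupClass.coe_zsmul, h',
      natCast_zsmul]
  have hA : ∀ x : geomTorsion W ((p : ℤ) ^ k), ((p : ℤ) ^ k) • x = 0 := fun x => by
    apply Subtype.ext
    have hx := x.2
    simp only [Submodule.mem_toAddSubgroup, Submodule.mem_torsionBy_iff] at hx
    rw [AddSubgroupClass.coe_zsmul, ZeroMemClass.coe_zero]
    exact hx
  obtain ⟨M, hM⟩ := exists_iterate_prime_pow_eq_pow_smul σ (a.val : ℤ) hσ hA
  refine ⟨σ₀ ^ p ^ M, (a.val : ℤ) ^ p ^ M, ?_, pow_mem hσ₀κ _, fun P => ?_⟩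
  · -- `a^{p^M} ≡ a ≢ 1 (mod p)` (Fermat)
    intro hdvd
    apply ha1
    have hcast : ((((a.val : ℤ) ^ p ^ M - 1 : ℤ)) : ZMod p) = 0 := by
      obtain ⟨c, hc⟩ := hdvd
      rw [hc, Int.cast_mul, Int.cast_natCast, ZMod.natCast_self, zero_mul]
    rw [Int.cast_sub, Int.cast_one, Int.cast_pow, Int.cast_natCast, ZMod.natCast_zmod_val, ZMod.pow_card_pow,
      sub_eq_zero] at hcast
    exact hcast
  · -- `σ₀^{p^M} • P = σ^[p^M] P`
    have hit : ∀ n : ℕ, (σ₀ ^ n) • P = σ^[n] P := by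
      intro n
      induction n with
      | zero => simp
      | succ n ih => rw [pow_succ', mul_smul, ih, Function.iterate_succ_apply']; rfl
    rw [hit, hM]

end Curve

end Summit.BirchSwinnertonDyer.BirchSwinnertonDyer.Theorems.OneSidedTwistSqueezeX9KatoDivisibilityX9CentralScalarPk

end
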